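import Literature.NumberTheory.EllipticCurves.TwoDescent
import HarnessLib

/-!
# The `2`-descent map `P ↦ x(P) − θ` attached to ONE root `θ` of the `2`-division cubic
# (Cassels, *Lectures on Elliptic Curves*, §15, Lemma 1) — the algebraic half of the generic `2`-descent

Topic `NumberTheory/EllipticCurves`; sequel of `TwoDescent.lean` (Silverman AEC Prop. X.1.4, the case of
SPLIT `2`-torsion `e₁, e₂, e₃ ∈ F`). Everything here is PROVED; no named fact, no `sorry`.

Cassels, LMSST 24, §15, treats "in a uniform manner the cases when `F(X)` has 3 rational roots, one
rational root, no rational root": with `Θ` the image of `T` in `ℚ[T]/F(T)`, `μ : 𝔊 → ℚ[Θ]*/(ℚ[Θ]*)²`,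
`μ(𝔬) = 1`, `μ(a, b) = (a − Θ)` (patched where `b = 0`), is a homomorphism (Lemma 1: collinear
`𝔞₁ + 𝔞₂ + 𝔞₃ = 0` on `Y = lX + m` give `F(X) − (lX + m)² = ∏ (X − aᵢ)`, "replace `X` by `Θ`"), with kernel
`2𝔊` (Lemma 2) and `Norm(a − Θ) = F(a)`. Read in ONE field `L` containing ONE root `θ` of the `2`-division
cubic this is the component of `μ` at the factor `L` of `ℚ[Θ]`; for IRREDUCIBLE `2`-division cubic and
`L = F(θ)` the cubic `2`-division field it is the whole of `μ` — the descent map of the generic complete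
`2`-descent (its arithmetic half, `L(S, 2)` of the cubic field, is not in the tree). Setting: a general
Weierstrass equation over a field of characteristic `0` and `θ` with `Ψ₂(θ) = 4θ³ + b₂θ² + 2b₄θ + b₆ = 0`
(`IsTwoTorsionX`, i.e. `T_θ = (θ, −(a₁θ + a₃)/2) ∈ E[2]`):

* `IsTwoTorsionX.Δ_eq` — **`Δ = 16 · c(θ)² · D(θ)`** with `c(θ) = Ψ₂'(θ)/4 = 3θ² + (b₂/2)θ + b₄/2`
  (`oneRootConst`; `= (θ − e₂)(θ − e₃)` over a splitting field), `D(θ) = b₂²/16 − 2b₄ − (b₂/2)θ − 3θ²`; hence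
  `c(θ) ≠ 0` on an elliptic curve (`oneRootConst_ne_zero`) — the one-root substitute for `e₁ ≠ e₂, e₁ ≠ e₃`;
* `mul_mul_addX_sub_eq_sq_of_isTwoTorsionX` — Cassels' identity `(x₁ − θ)(x₂ − θ)(x₃ − θ) = □` for
  `P₁ + P₂ = (x₃, *)` (Mathlib's `addPolynomial_slope` evaluated at `X = θ`);
  `addX_twoTorsion_sub_mul_of_isTwoTorsionX` — translation by `T_θ`: `(x(P + T_θ) − θ)(x(P) − θ) = c(θ)`;
* `Point.oneRootComponent W θ : E(L) → Lˣ/(Lˣ)²`, `P ↦ x(P) − θ`, `T_θ ↦ c(θ)`, `O ↦ 1`, and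
  **`Point.oneRootComponent_add`** — it is a homomorphism (Cassels §15 Lemma 1); `oneRootHom`,
  `oneRootComponent_two_nsmul`, `oneRootComponent_eq_twoDescentComponent` (split case = `TwoDescent.lean`);
* `mul_quadratic_eq_sq_of_equation` — the square-norm relation in elementary form: on the curve,
  `(x − θ) · (4x² + (4θ + b₂)x + 4θ² + b₂θ + 2b₄) = (2y + a₁x + a₃)²` (Cassels' `Norm(a − Θ) = F(a) ∈ ℚ*²`);
* `Point.casselsMap W L θ : E(F) →+ Lˣ/(Lˣ)²` — for `W/F`, an extension `L/F` and a root `θ ∈ L` of `Ψ₂`: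
  base change `E(F) → E(L)` (Mathlib `Affine.Point.baseChange`) followed by `oneRootHom`; `casselsMap_some`
  (value `x(P) − θ` when `x(P) ≠ θ`, e.g. always when `Ψ₂` is irreducible over `F`), `casselsMap_two_nsmul`.

Not here: kernel exactly `2E(F)` when `E(F)[2] = 0` (Cassels §15 Lemma 2), image in `L(S, 2)`.

## References

* [Cassels1991LecturesEllipticCurves] J. W. S. Cassels, *Lectures on Elliptic Curves*, LMSST 24, CUP 1991, §15
  (pp. 42–44): the map `μ`, Lemma 1 (homomorphism), Lemma 2 (kernel `2𝔊`), `Norm(a − Θ) = F(a)`.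
* [SilvermanAEC2009] J. H. Silverman, *The Arithmetic of Elliptic Curves*, 2nd ed. (2009), Prop. X.1.4, III.2.3, III.§1.

Design: conventions of `TwoDescent.lean` (dot-notation extensions of Mathlib's `WeierstrassCurve.Affine[.Point]`,
general Weierstrass equation, `CharZero`, the tree's `SqUnits`/`sqClass`, `[DecidableEq]` for the group law); the
`linear_combination` cofactors (notably in `IsTwoTorsionX.Δ_eq`) were found by polynomial division in `θ`.
-/

noncomputable section

namespace WeierstrassCurve.Affine

variable {F : Type*} [Field F] {W : Affine F}

/-! ### One root of the `2`-division cubic -/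

/-- `θ` is the `x`-coordinate of a `2`-torsion point of `W`: a root of the `2`-division cubic
`Ψ₂(x) = 4x³ + b₂x² + 2b₄x + b₆` (`= (2y + a₁x + a₃)²` on the curve), i.e.
`T_θ = (θ, −(a₁θ + a₃)/2) ∈ E[2]` (Silverman AEC III.2.3(d); Cassels §15: `Θ ↦ θ` is one factor of `ℚ[Θ]`).
[cite: Cassels1991LecturesEllipticCurves, §15 (the ring ℚ[Θ])] -/
structure IsTwoTorsionX (W : Affine F) (θ : F) : Prop where
  /-- `Ψ₂(θ) = 0`. -/
  eq : 4 * θ ^ 3 + W.b₂ * θ ^ 2 + 2 * W.b₄ * θ + W.b₆ = 0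

variable (W) in
/-- The constant `c(θ) = Ψ₂'(θ)/4 = 3θ² + (b₂/2)θ + b₄/2` attached to a root `θ` of the `2`-division cubic;
over a splitting field `Ψ₂ = 4(x − θ)(x − e₂)(x − e₃)` it is `(θ − e₂)(θ − e₃)`, the value of the descent
map at `T_θ` (Silverman AEC Prop. X.1.4: `T₁ ↦ (e₁ − e₃)/(e₁ − e₂) ≡ (e₁ − e₂)(e₁ − e₃)`; Cassels §15
(iii), the "patched" component). [cite: Cassels1991LecturesEllipticCurves, §15 (iii)] -/
def oneRootConst (θ : F) : F := 3 * θ ^ 2 + W.b₂ / 2 * θ + W.b₄ / 2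

namespace IsTwoTorsionX

variable {θ e₁ e₂ e₃ : F}

/-- Split `2`-torsion gives a root: `e₁` is a root of `Ψ₂ = 4(x − e₁)(x − e₂)(x − e₃)`. [cite: SilvermanAEC2009, Prop. X.1.4] -/
lemma of_splitTwoTorsion (h : W.SplitTwoTorsion e₁ e₂ e₃) : W.IsTwoTorsionX e₁ := by
  refine ⟨?_⟩
  rw [h.b₂_eq, h.b₄_eq, h.b₆_eq]
  ring

/-- For split `2`-torsion, `c(e₁) = (e₁ − e₂)(e₁ − e₃)` (Silverman's value of the descent map at `T₁`). [cite: SilvermanAEC2009, Prop. X.1.4] -/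
lemma oneRootConst_eq_of_splitTwoTorsion [CharZero F] (h : W.SplitTwoTorsion e₁ e₂ e₃) :
    W.oneRootConst e₁ = (e₁ - e₂) * (e₁ - e₃) := by
  rw [oneRootConst, h.b₂_eq, h.b₄_eq]
  field_simp
  ring

/-- **`Δ = 16 · c(θ)² · D(θ)`**, `D(θ) = b₂²/16 − 2b₄ − (b₂/2)θ − 3θ²` the discriminant of the quadratic
`Ψ₂/(4(x − θ))`: the one-root form of `Δ = 16 ∏ (eᵢ − eⱼ)²` (an identity modulo `Ψ₂(θ) = 0`; cofactor found by
polynomial division). [cite: SilvermanAEC2009, §III.1 (Δ and the 2-division polynomial)] -/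
lemma Δ_eq [CharZero F] (h : W.IsTwoTorsionX θ) :
    W.Δ = 16 * W.oneRootConst θ ^ 2 * (W.b₂ ^ 2 / 16 - 2 * W.b₄ - W.b₂ / 2 * θ - 3 * θ ^ 2) := by
  have hΨ := h.eq
  simp only [b₂, b₄, b₆] at hΨ
  simp only [Δ, b₂, b₄, b₆, b₈, oneRootConst]
  linear_combination ((108 : F) * θ ^ 3 + (27 : F) * θ ^ 2 * W.a₁ ^ 2 + (108 : F) * θ ^ 2 * W.a₂
    + (54 : F) * θ * W.a₁ * W.a₃ + (108 : F) * θ * W.a₄ + (-1 / 4 : F) * W.a₁ ^ 6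
    + (-3 : F) * W.a₁ ^ 4 * W.a₂ + (9 : F) * W.a₁ ^ 3 * W.a₃ + (-12 : F) * W.a₁ ^ 2 * W.a₂ ^ 2
    + (18 : F) * W.a₁ ^ 2 * W.a₄ + (36 : F) * W.a₁ * W.a₂ * W.a₃ + (-16 : F) * W.a₂ ^ 3
    + (72 : F) * W.a₂ * W.a₄ + (-27 : F) * W.a₃ ^ 2 + (-108 : F) * W.a₆) * hΨ

/-- On an elliptic curve (`Δ ≠ 0`) the constant `c(θ) = Ψ₂'(θ)/4` of a root `θ` is non-zero (`θ` is a simple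
root): the one-root substitute for `e₁ ≠ e₂`, `e₁ ≠ e₃` (Cassels works throughout with `F` without multiple roots).
[cite: Cassels1991LecturesEllipticCurves, §15 Lemma 1 (hypothesis: F has distinct roots)] -/
lemma oneRootConst_ne_zero [CharZero F] [W.IsElliptic] (h : W.IsTwoTorsionX θ) :
    W.oneRootConst θ ≠ 0 := by
  intro h0
  apply W.Δ'.ne_zero
  rw [coe_Δ', h.Δ_eq, h0]
  ring

/-- The `2`-torsion point `T_θ = (θ, −(a₁θ + a₃)/2)` lies on the curve (`Ψ₂(θ) = 0` is exactly its equation).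
[cite: SilvermanAEC2009, Prop. III.2.3(d)] -/
lemma equation_twoTorsion [CharZero F] (h : W.IsTwoTorsionX θ) : W.Equation θ (W.twoTorsionY θ) := by
  have hΨ := h.eq
  simp only [b₂, b₄, b₆] at hΨ
  rw [equation_iff, twoTorsionY]
  linear_combination (-(1 / 4 : F)) * hΨ

/-- `T_θ` is a nonsingular point of the elliptic curve. [cite: SilvermanAEC2009, Prop. III.2.3(d)] -/
lemma nonsingular_twoTorsion [CharZero F] [W.IsElliptic] (h : W.IsTwoTorsionX θ) :
    W.Nonsingular θ (W.twoTorsionY θ) :=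
  equation_iff_nonsingular.mp h.equation_twoTorsion

end IsTwoTorsionX

variable {θ : F}

/-- A point with the `x`-coordinate of `T_θ` is `T_θ` (`[2]P = O` iff `P = −P`). [cite: SilvermanAEC2009, Prop. III.2.3(d)] -/
lemma eq_twoTorsionY_of_isTwoTorsionX [CharZero F] (h : W.IsTwoTorsionX θ) {y₁ : F}
    (h₁ : W.Nonsingular θ y₁) : y₁ = W.twoTorsionY θ := by
  rcases Y_eq_of_X_eq h₁.1 h.equation_twoTorsion rfl with hy | hy
  · exact hy
  · rwa [negY_twoTorsionY] at hy

variable [DecidableEq F]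

/-- **Cassels' identity** (LMSST 24, §15, proof of Lemma 1: "replace `X` by `Θ`"): if `T_θ` is a `2`-torsion
point and `P₁ = (x₁, y₁)`, `P₂ = (x₂, y₂)`, `P₁ + P₂ = (x₃, *)`, then `(x₁ − θ)(x₂ − θ)(x₃ − θ)` is the square
`(ℓ(θ − x₁) + y₁ − y_{T_θ})²`, `ℓ` the slope of the chord/tangent — Mathlib's `addPolynomial_slope`
evaluated at `X = θ`. [cite: Cassels1991LecturesEllipticCurves, §15 Lemma 1] -/
lemma mul_mul_addX_sub_eq_sq_of_isTwoTorsionX [CharZero F] (h : W.IsTwoTorsionX θ) {x₁ x₂ y₁ y₂ : F}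
    (h₁ : W.Nonsingular x₁ y₁) (h₂ : W.Nonsingular x₂ y₂) (hxy : ¬(x₁ = x₂ ∧ y₁ = W.negY x₂ y₂)) :
    (x₁ - θ) * (x₂ - θ) * (W.addX x₁ x₂ (W.slope x₁ x₂ y₁ y₂) - θ) =
      (W.slope x₁ x₂ y₁ y₂ * (θ - x₁) + y₁ - W.twoTorsionY θ) ^ 2 := by
  have hp := congrArg (Polynomial.eval θ) (addPolynomial_slope h₁.1 h₂.1 hxy)
  rw [eval_addPolynomial] at hp
  simp only [Polynomial.eval_neg, Polynomial.eval_mul, Polynomial.eval_sub, Polynomial.eval_X,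
    Polynomial.eval_C] at hp
  have hT := h.equation_twoTorsion
  rw [equation_iff] at hT
  have hn := negY_twoTorsionY (W := W) θ
  rw [negY] at hn
  linear_combination -hp + hT - (W.slope x₁ x₂ y₁ y₂ * (θ - x₁) + y₁ - W.twoTorsionY θ) * hn

omit [DecidableEq F] in
/-- Clearing the denominator in `addX`: `d² x₃ = n² + a₁nd − (a₂ + x₁ + x₂)d²` for `ℓ = n/d`. [folklore] -/
private lemma sq_mul_addX_div_oneRoot (x₁ x₂ n d : F) (hd : d ≠ 0) :
    d ^ 2 * W.addX x₁ x₂ (n / d) = n ^ 2 + W.a₁ * n * d - (W.a₂ + x₁ + x₂) * d ^ 2 := by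
  simp only [addX]
  field_simp
  ring

/-- **Translation by `T_θ`**: for `P = (x₁, y₁)` with `x₁ ≠ θ`, `(x(P + T_θ) − θ)(x₁ − θ) = c(θ)` (the
classical `x(P + T) − e = (e − e')(e − e'')/(x(P) − e)`, in one-root form; an identity modulo `Ψ₂(θ) = 0`
and the equation at `P`; the case `𝔞₂ = T_θ` of Cassels' Lemma 1). [cite: Cassels1991LecturesEllipticCurves, §15 Lemma 1] -/
lemma addX_twoTorsion_sub_mul_of_isTwoTorsionX [CharZero F] (h : W.IsTwoTorsionX θ) {x₁ y₁ : F}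
    (h₁ : W.Nonsingular x₁ y₁) (hx : x₁ ≠ θ) :
    (W.addX x₁ θ (W.slope x₁ θ y₁ (W.twoTorsionY θ)) - θ) * (x₁ - θ) = W.oneRootConst θ := by
  have hd : x₁ - θ ≠ 0 := sub_ne_zero.mpr hx
  have key := sq_mul_addX_div_oneRoot (W := W) x₁ θ (y₁ - W.twoTorsionY θ) (x₁ - θ) hd
  have hΨ := h.eq
  simp only [b₂, b₄, b₆] at hΨ
  have hE := h₁.1
  rw [equation_iff] at hE
  rw [slope_of_X_ne hx]
  rw [twoTorsionY] at key ⊢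
  rw [oneRootConst, b₂, b₄]
  refine mul_left_injective₀ hd ?_
  dsimp only
  linear_combination key + hE + (1 / 4 : F) * hΨ

namespace Point

variable (W θ) in
omit [DecidableEq F] in
/-- **The one-root `2`-descent map** `E(L) → Lˣ/(Lˣ)²` of the root `θ`: `P = (x, y) ↦ x − θ` for `x ≠ θ`,
`T_θ ↦ c(θ)`, `O ↦ 1` (Cassels §15, the `θ`-component of `μ`; for split `2`-torsion the `T₁`-component of
Silverman AEC Prop. X.1.4, `oneRootComponent_eq_twoDescentComponent`).
[cite: Cassels1991LecturesEllipticCurves, §15 (definition of μ)] -/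
def oneRootComponent : W.Point → SqUnits F
  | 0 => 1
  | some x _ _ => if x = θ then sqClass (W.oneRootConst θ) else sqClass (x - θ)

/-- The one-root component of `O` is `1`. [cite: Cassels1991LecturesEllipticCurves, §15 (i)] -/
@[simp] lemma oneRootComponent_zero : oneRootComponent W θ 0 = 1 := rfl

/-- The one-root component of a point with `x = θ` is `c(θ)`. [cite: Cassels1991LecturesEllipticCurves, §15 (iii)] -/
lemma oneRootComponent_some_of_eq {x y : F} (hP : W.Nonsingular x y) (hx : x = θ) :
    oneRootComponent W θ (some x y hP) = sqClass (W.oneRootConst θ) := by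
  rw [oneRootComponent, if_pos hx]

/-- The one-root component of `(x, y)` with `x ≠ θ` is `x − θ`. [cite: Cassels1991LecturesEllipticCurves, §15 (ii)] -/
lemma oneRootComponent_some_of_ne {x y : F} (hP : W.Nonsingular x y) (hx : x ≠ θ) :
    oneRootComponent W θ (some x y hP) = sqClass (x - θ) := by
  rw [oneRootComponent, if_neg hx]

/-- The one-root component is even: `δ(−P) = δ(P)` (it only depends on `x`). [cite: Cassels1991LecturesEllipticCurves, §15 Lemma 1] -/
lemma oneRootComponent_neg (P : W.Point) :
    oneRootComponent W θ (-P) = oneRootComponent W θ P := by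
  rcases P with _ | ⟨x, y, hP⟩
  · rfl
  · rw [neg_some]
    by_cases hx : x = θ
    · rw [oneRootComponent_some_of_eq _ hx, oneRootComponent_some_of_eq _ hx]
    · rw [oneRootComponent_some_of_ne _ hx, oneRootComponent_some_of_ne _ hx]

variable [CharZero F] [W.IsElliptic]

/-- `T_θ + Q` for `Q = (x₂, y₂)`, `x₂ ≠ θ`. [folklore] -/
private lemma oneRootComponent_twoTorsion_add (h : W.IsTwoTorsionX θ) {x₂ y₂ : F}
    (h₂ : W.Nonsingular x₂ y₂) (hx₂ : x₂ ≠ θ) :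
    oneRootComponent W θ (some x₂ y₂ h₂ + some θ _ h.nonsingular_twoTorsion) =
      sqClass (W.oneRootConst θ) * sqClass (x₂ - θ) := by
  have key := addX_twoTorsion_sub_mul_of_isTwoTorsionX h h₂ hx₂
  rw [add_of_X_ne hx₂]
  have hx₃ : W.addX x₂ θ (W.slope x₂ θ y₂ (W.twoTorsionY θ)) - θ ≠ 0 := by
    intro h0
    rw [h0, zero_mul] at key
    exact h.oneRootConst_ne_zero key.symm
  rw [oneRootComponent_some_of_ne _ (sub_ne_zero.mp hx₃)]
  apply SqUnits.eq_mul_of_mul_eq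
  rw [← sqClass_mul hx₃ (sub_ne_zero.mpr hx₂), key]

/-- **The one-root `2`-descent map is a homomorphism** `E(L) → Lˣ/(Lˣ)²` (Cassels, LMSST 24, §15,
Lemma 1; by Cassels' identity `mul_mul_addX_sub_eq_sq_of_isTwoTorsionX` and the translation formula
`addX_twoTorsion_sub_mul_of_isTwoTorsionX`). [cite: Cassels1991LecturesEllipticCurves, §15 Lemma 1] -/
theorem oneRootComponent_add (h : W.IsTwoTorsionX θ) (P Q : W.Point) :
    oneRootComponent W θ (P + Q) = oneRootComponent W θ P * oneRootComponent W θ Q := by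
  rcases P with _ | ⟨x₁, y₁, h₁⟩
  · rw [← zero_def, zero_add, oneRootComponent_zero, SqUnits.one_mul]
  rcases Q with _ | ⟨x₂, y₂, h₂⟩
  · rw [← zero_def, add_zero, oneRootComponent_zero, SqUnits.mul_one]
  have hc := h.oneRootConst_ne_zero
  by_cases hx₁ : x₁ = θ
  · subst hx₁
    obtain rfl := eq_twoTorsionY_of_isTwoTorsionX h h₁
    rw [oneRootComponent_some_of_eq _ rfl]
    by_cases hx₂ : x₂ = x₁
    · subst hx₂
      obtain rfl := eq_twoTorsionY_of_isTwoTorsionX h h₂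
      rw [oneRootComponent_some_of_eq _ rfl, add_self_of_Y_eq (negY_twoTorsionY _).symm,
        oneRootComponent_zero]
      exact (SqUnits.mul_self _).symm
    · rw [add_comm, oneRootComponent_twoTorsion_add h h₂ hx₂, oneRootComponent_some_of_ne _ hx₂]
  by_cases hx₂ : x₂ = θ
  · subst hx₂
    obtain rfl := eq_twoTorsionY_of_isTwoTorsionX h h₂
    rw [oneRootComponent_twoTorsion_add h h₁ hx₁, oneRootComponent_some_of_ne _ hx₁,
      oneRootComponent_some_of_eq _ rfl]
    exact SqUnits.mul_comm _ _
  rw [oneRootComponent_some_of_ne _ hx₁, oneRootComponent_some_of_ne _ hx₂]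
  by_cases hxy : x₁ = x₂ ∧ y₁ = W.negY x₂ y₂
  · rw [add_of_Y_eq hxy.1 hxy.2, oneRootComponent_zero, hxy.1, ← sqClass_mul
      (sub_ne_zero.mpr hx₂) (sub_ne_zero.mpr hx₂), sqClass_mul_self]
  rw [add_some hxy]
  by_cases hx₃ : W.addX x₁ x₂ (W.slope x₁ x₂ y₁ y₂) = θ
  · -- `P + Q = T_θ`, so `Q = −P + T_θ`
    rw [oneRootComponent_some_of_eq _ hx₃]
    have hPQ : some x₁ y₁ h₁ + some x₂ y₂ h₂ = some θ _ h.nonsingular_twoTorsion := by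
      rw [add_some hxy]
      simp only [some.injEq]
      exact ⟨hx₃, eq_twoTorsionY_of_isTwoTorsionX h (hx₃ ▸ nonsingular_add h₁ h₂ hxy)⟩
    have hQ : some x₂ y₂ h₂ = -some x₁ y₁ h₁ + some θ _ h.nonsingular_twoTorsion :=
      eq_neg_add_iff_add_eq.mpr hPQ
    rw [neg_some, add_of_X_ne hx₁, some.injEq] at hQ
    have key := addX_twoTorsion_sub_mul_of_isTwoTorsionX h ((nonsingular_neg ..).mpr h₁) hx₁
    rw [← hQ.1] at key
    rw [← sqClass_mul (sub_ne_zero.mpr hx₁) (sub_ne_zero.mpr hx₂),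
      show (x₁ - θ) * (x₂ - θ) = W.oneRootConst θ by rw [mul_comm]; exact key]
  · rw [oneRootComponent_some_of_ne _ hx₃]
    exact sqClass_eq_mul_of_mul_mul_eq_sq (sub_ne_zero.mpr hx₁) (sub_ne_zero.mpr hx₂)
      (sub_ne_zero.mpr hx₃) (mul_mul_addX_sub_eq_sq_of_isTwoTorsionX h h₁ h₂ hxy)

/-- `2E(L)` dies under the one-root descent map (`Lˣ/(Lˣ)²` has exponent `2`); Cassels §15 Lemma 2 is the
converse for the full map `μ`. [cite: Cassels1991LecturesEllipticCurves, §15 Lemma 2] -/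
theorem oneRootComponent_two_nsmul (h : W.IsTwoTorsionX θ) (P : W.Point) :
    oneRootComponent W θ (2 • P) = 1 := by
  rw [two_nsmul, oneRootComponent_add h, SqUnits.mul_self]

variable (W) in
/-- The one-root `2`-descent map as a group homomorphism `E(L) →+ Lˣ/(Lˣ)²` (written additively).
[cite: Cassels1991LecturesEllipticCurves, §15 Lemma 1] -/
def oneRootHom (h : W.IsTwoTorsionX θ) : W.Point →+ Additive (SqUnits F) where
  toFun P := Additive.ofMul (oneRootComponent W θ P)
  map_zero' := rfl
  map_add' P Q := by rw [oneRootComponent_add h, ofMul_mul]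

/-- `oneRootHom` is `oneRootComponent`. [cite: Cassels1991LecturesEllipticCurves, §15 Lemma 1] -/
lemma oneRootHom_apply (h : W.IsTwoTorsionX θ) (P : W.Point) :
    oneRootHom W h P = Additive.ofMul (oneRootComponent W θ P) := rfl
omit [W.IsElliptic] in
/-- For SPLIT `2`-torsion the one-root map at `e₁` is the `T₁`-component of the complete `2`-descent map of
`TwoDescent.lean` (Silverman AEC Prop. X.1.4). [cite: SilvermanAEC2009, Prop. X.1.4] -/
theorem oneRootComponent_eq_twoDescentComponent {e₁ e₂ e₃ : F} (h : W.SplitTwoTorsion e₁ e₂ e₃)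
    (P : W.Point) : oneRootComponent W e₁ P = twoDescentComponent W e₁ e₂ e₃ P := by
  rcases P with _ | ⟨x, y, hP⟩
  · rfl
  · by_cases hx : x = e₁
    · rw [oneRootComponent_some_of_eq _ hx, twoDescentComponent_some_of_eq _ hx,
        IsTwoTorsionX.oneRootConst_eq_of_splitTwoTorsion h]
    · rw [oneRootComponent_some_of_ne _ hx, twoDescentComponent_some_of_ne _ hx]

end Point

/-! ### The square-norm relation -/

omit [DecidableEq F] in
/-- On the curve, `Ψ₂(x) = (2y + a₁x + a₃)²`. [cite: SilvermanAEC2009, §III.1 (2-division polynomial)] -/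
lemma twoDivision_eval_eq_sq_of_equation {x y : F} (hxy : W.Equation x y) :
    4 * x ^ 3 + W.b₂ * x ^ 2 + 2 * W.b₄ * x + W.b₆ = (2 * y + W.a₁ * x + W.a₃) ^ 2 := by
  rw [equation_iff] at hxy
  simp only [b₂, b₄, b₆]
  linear_combination (-4 : F) * hxy

omit [DecidableEq F] in
/-- **Square norm** (Cassels §15: `Norm(a − Θ) = F(a)`, a square for `a = x(P)`), in elementary one-root form:
`Ψ₂(X) = (X − θ) · (4X² + (4θ + b₂)X + (4θ² + b₂θ + 2b₄))` when `Ψ₂(θ) = 0`, so on the curve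
`(x − θ) · (4x² + (4θ + b₂)x + 4θ² + b₂θ + 2b₄) = (2y + a₁x + a₃)²`; for `L = F(θ)` cubic over `F` and
`x, y ∈ F` the left side is `4·N_{L/F}(x − θ)`. [cite: Cassels1991LecturesEllipticCurves, §15 (Norm(a − Θ) = F(a))] -/
theorem mul_quadratic_eq_sq_of_equation (h : W.IsTwoTorsionX θ) {x y : F} (hxy : W.Equation x y) :
    (x - θ) * (4 * x ^ 2 + (4 * θ + W.b₂) * x + (4 * θ ^ 2 + W.b₂ * θ + 2 * W.b₄)) =
      (2 * y + W.a₁ * x + W.a₃) ^ 2 := by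
  rw [← twoDivision_eval_eq_sq_of_equation hxy]
  linear_combination (-1 : F) * h.eq

/-! ### The Cassels map of a curve over `F` at a root `θ` in an extension field `L` -/

namespace Point

variable {K : Type*} [Field K] [DecidableEq K] {V : WeierstrassCurve K} (L : Type*) [Field L] [Algebra K L]
  [DecidableEq L] [CharZero L] {ϑ : L}

/-- **The Cassels map** `E(K) →+ Lˣ/(Lˣ)²`, `P ↦ x(P) − ϑ`, of a Weierstrass curve `V/K` at a root `ϑ ∈ L` of
its `2`-division cubic in an extension field `L/K` (e.g. `L = K(ϑ)` the cubic `2`-division field when `Ψ₂` is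
irreducible over `K`: then this is Cassels' `μ` itself): base change `E(K) → E(L)` followed by the one-root
descent homomorphism of `V/L`. [cite: Cassels1991LecturesEllipticCurves, §15 Lemma 1] -/
def casselsMap [(V.baseChange L).IsElliptic] (h : (V.baseChange L).toAffine.IsTwoTorsionX ϑ) :
    V.toAffine.Point →+ Additive (SqUnits L) :=
  (oneRootHom (V.baseChange L).toAffine h).comp (baseChange (W' := V) K L)

/-- The Cassels map is `P ↦ oneRootComponent (P_L)`. [cite: Cassels1991LecturesEllipticCurves, §15 Lemma 1] -/
lemma casselsMap_apply [(V.baseChange L).IsElliptic] (h : (V.baseChange L).toAffine.IsTwoTorsionX ϑ)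
    (P : V.toAffine.Point) :
    casselsMap L h P = Additive.ofMul (oneRootComponent (V.baseChange L).toAffine ϑ
      (baseChange (W' := V) K L P)) := rfl

/-- **Value of the Cassels map**: for `P = (x, y) ∈ E(K)` with `x ≠ ϑ` in `L` (automatic when `Ψ₂` is irreducible
over `K`, `ϑ ∉ K`), `μ(P) = (x − ϑ)·(Lˣ)²`. [cite: Cassels1991LecturesEllipticCurves, §15 (ii)] -/
theorem casselsMap_some [(V.baseChange L).IsElliptic] (h : (V.baseChange L).toAffine.IsTwoTorsionX ϑ)
    {x y : K} (hP : V.toAffine.Nonsingular x y) (hx : algebraMap K L x ≠ ϑ) :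
    casselsMap L h (some x y hP) = Additive.ofMul (sqClass (algebraMap K L x - ϑ)) := by
  rw [casselsMap_apply]
  show Additive.ofMul (oneRootComponent (V.baseChange L).toAffine ϑ
    (some (algebraMap K L x) (algebraMap K L y) _)) = _
  rw [oneRootComponent_some_of_ne _ hx]

/-- `μ(O) = 1`. [cite: Cassels1991LecturesEllipticCurves, §15 (i)] -/
theorem casselsMap_zero [(V.baseChange L).IsElliptic] (h : (V.baseChange L).toAffine.IsTwoTorsionX ϑ) :
    casselsMap L h 0 = 0 := (casselsMap L h).map_zero

/-- `2E(K)` dies under the Cassels map. [cite: Cassels1991LecturesEllipticCurves, §15 Lemma 2] -/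
theorem casselsMap_two_nsmul [(V.baseChange L).IsElliptic] (h : (V.baseChange L).toAffine.IsTwoTorsionX ϑ)
    (P : V.toAffine.Point) : casselsMap L h (2 • P) = 0 := by
  have h2 : casselsMap L h (2 • P) = 2 • casselsMap L h P := map_nsmul _ _ _
  rw [h2, casselsMap_apply, two_nsmul, ← ofMul_mul, SqUnits.mul_self, ofMul_one]

omit [DecidableEq K] [DecidableEq L] [CharZero L] in
/-- **Square norm for the Cassels map**: for `P = (x, y) ∈ E(K)`, in `L`,
`(x − ϑ)·(4x² + (4ϑ + b₂)x + 4ϑ² + b₂ϑ + 2b₄) = (2y + a₁x + a₃)²` — the representative `x − ϑ` of `μ(P)` times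
its "cofactor" is a square of `K` (Cassels: `Norm(x − Θ) = F(x) ∈ ℚ*²`).
[cite: Cassels1991LecturesEllipticCurves, §15 (Norm(a − Θ) = F(a))] -/
theorem casselsMap_norm_relation (h : (V.baseChange L).toAffine.IsTwoTorsionX ϑ) {x y : K}
    (hP : V.toAffine.Equation x y) :
    (algebraMap K L x - ϑ) * (4 * algebraMap K L x ^ 2 + (4 * ϑ + (V.baseChange L).b₂) * algebraMap K L x
      + (4 * ϑ ^ 2 + (V.baseChange L).b₂ * ϑ + 2 * (V.baseChange L).b₄)) =
      algebraMap K L (2 * y + V.a₁ * x + V.a₃) ^ 2 := by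
  have hL : (V.baseChange L).toAffine.Equation (algebraMap K L x) (algebraMap K L y) :=
    (map_equation (W := V.toAffine) (f := algebraMap K L) (algebraMap K L).injective x y).mpr hP
  rw [mul_quadratic_eq_sq_of_equation h hL]
  simp only [map_add, map_mul, map_ofNat]
  rfl

end Point

end WeierstrassCurve.Affine

end
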